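import Mathlib
import Literature.MathematicalPhysics.QuantumFieldTheory.Balaban1983to89.B11SectG

/-!
# `Balaban1983to89.B9SectDL2Decay` — [Balaban1985BackgroundPropagators] Sect. D, Theorem 3.12 (p. 423): the
BLOCK-L² HALF — the six L²-entries (3.46) of Theorem 3.3 for the Sect.-D propagators G = (G₀⁻¹ − Δ′_π)⁻¹ (3.130) and
G₁ = (G₀⁻¹ − Δ′_π − Δ^{(2)}_π)⁻¹ (3.138), WITH their exponential block decay, by Neumann bookkeeping in weighted
block-L² operator norms — kernel-checked over the block-majorant calculus of `…B11SectG`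

CITATION HEADER (lean-in-tree rule 2026-08-18).  Source under reading: T. Bałaban, *Propagators for lattice gauge
theories in a background field*, Commun. Math. Phys. **99**, 389–434 (1985), doi:10.1007/bf01240355
[`Balaban1985BackgroundPropagators`] (cell paper B9; held `paper:balaban1985-cmp99-background-propagators`; journal
page = PDF page + 388; every quotation below is read from the page renders
`b2b-balaban-ref1/pages/1985-cmp99-background-propagators/…-p010,p011,p031,p032,p033,p034,p035-x2.png`), and T. Bałaban,
*Propagators and renormalization transformations for lattice gauge theories. II*, Commun. Math. Phys. **96**, 223–250
(1984) [`Balaban1984PropagatorsII`] (cell paper B6 = ref. [4] of B9), Lemma 2.1 p. 234.  PRINTED INPUTS (theorem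
STATEMENTS only, never the disputed steps): (3.46) p. 398, verbatim: *"Finally, we have the inequalities in L²-norms
‖hG′(U)λ‖, ‖h∇_UG′(U)λ‖, ‖hG′(U)∇*_Uλ‖, ‖h∇_U∇_UG′(U)λ‖, ‖h∇_UG′(U)∇*_Uλ‖, ‖hG′(U)∇*_U∇*_Uλ‖ ≤ B₀[(L^jη)², L^jη,
L^jη, 1, 1, 1]|h|e^{−δ₀d(y,y′)}‖λ‖ for supp h ⊂ Δ(y), y ∈ Λ_j, supp λ ⊂ Δ(y′); (3.46)"*, with the remark of p. 398:
*"At first the choice of derivatives ∇_U, ∇*_U is conventional, we may always replace ∇_U by ∇*_U, and vice versa,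
in arbitrary place and combination. Next, the choice of powers L^jη is conventional also. Using Lemma 2.1 in [4] we
may replace the factor (L^jη)^α by (L^jη)^β(L^{j′}η)^γ with β + γ = α, j, j′ are indices of localizations."*;
Theorem 3.3 p. 399: *"Under the assumptions of Theorem 3.1, and with the constants described there, the operator G(U)
(a = 1) satisfies the inequalities (3.42)–(3.47), with G′(U) replaced by G(U) and λ replaced by a function J defined at
bonds of the lattice T_η, or Ω₀, and with values in 𝔤."*; (3.49) p. 399: *"[|P(x,x′)|, |(DP)_μ(x,x′)|, |(PD*)_ν(x,x′)|,
|(DPD*)_{μν}(x,x′)|] ≤ O(1)[1, (L^jη)⁻¹, (L^jη)⁻¹, (L^jη)⁻²](L^{j′}η)^{−d}e^{−(1/2)δ₀d(y,y′)} for x ∈ Δ(y), y ∈ Λ_j,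
x′ ∈ Δ(y′), y′ ∈ Λ_{j′}."*; (3.122) p. 420: *"G⁻¹ defined as G⁻¹ = Δ_π + DRD* + Q*aQ"*; (3.130) p. 421: *"Let us denote for a moment the operator we have investigated in previous
sections by G₀, i.e. G₀ = (Δ + DRD* + Q*aQ)⁻¹. From (3.120) we get G = G₀(I − Δ′_πG₀)⁻¹ =
Σ_{n=0}^∞ G₀(Δ′_πG₀)ⁿ. (3.130)"* (so that G = G₀ + G₀Δ′_πG₀ + ⋯ — our gloss, not printed) and *"It is easy to find
estimates for the operator Δ′_π, using Theorem 3.1 and the inequality (3.49), we have to be careful only with the third term in the definition (3.120) of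
Δ′_π. One of the three derivatives there has to be applied either to an expression on the right, or on the left, of
Δ′_π"*; (3.131) p. 422: *"|⟨A₁Δ′_πA₂⟩| ≤ O(1)Mα₀(‖D*A₁‖_{L¹} + (L^jη)⁻¹‖A₁‖_{L¹})e^{−(1/2)δ₀d(y,y′)}(|D*A₂| +
(L^{j′}η)⁻¹|A₂|) for supp A₁ ⊂ Δ(y), y ∈ Λ_j, supp A₂ ⊂ Δ(y′), y′ ∈ Λ_{j′}. (3.131) This inequality and Theorem 3.3 for
G₀ imply a convergence of the series (3.130), for α₀ sufficiently small, in all norms appearing on the left-hand sides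
of the inequalities (3.42)–(3.47), except the inequality involving the Laplace operator in (3.42)."*; (3.135) p. 422:
*"Δ^{(2)}_π = Δ^{(2)} − DRG′D*Δ^{(2)} − Δ^{(2)}DG′RD* + DRG′D*Δ^{(2)}DG′RD*."*; (3.137)–(3.138) p. 423: *"|(Δ^{(2)}A)(b)| ≤
O(1)Mα₀(L^jη)⁻²|A|, b ∈ Δ(y), y ∈ Λ_j, (3.137) and the supremum |A| is taken over several j-blocks surrounding Δ(y).
… Similarly as in (3.130) we get G₁ = G₀(I − (Δ′_π + Δ^{(2)}_π)G₀)⁻¹ = Σ_{n=0}^∞ G₀((Δ′_π + Δ^{(2)}_π)G₀)ⁿ. (3.138) …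
the series (3.138) is convergent for α₀ restricted by a small, absolute constant. The convergence is in all norms
appearing in the formulation of Theorem 3.3. This implies that the theorem is valid for G₁."*; Theorem 3.12 p. 423:
*"If an external gauge field configuration U satisfies both regularity conditions (3.35), (3.36) for α₀ sufficiently
small, then Theorems 3.3, 3.10, 3.11 hold for the propagators G, G₁, with one exception … The exception is the
inequality in (3.42) involving the covariant Laplace operator. It does not hold for G, G₁."*; [4] Lemma 2.1 (2.60)
p. 234 (`B6RandomWalk.Ineq260`) and (2.61) (`B11SectG.RowSum` via `B11SectG.rowSum_iff_ineq261`).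

v1.2 (docstring-only over v1.1 p179343; cell GAPS G-pv10-10 V3, recorded by the cross-reader pv10-g4): the (3.130)
quotation re-typed VERBATIM (v1.0/v1.1 carried the gloss "= G₀ + G₀Δ′_πG₀ + ⋯" inside the quotation marks), the comma
after "the operator Δ′_π" restored, and the render list completed with p031 (p. 419) and p032 (p. 420); no declaration
changed.

WHAT IS REPRODUCED.  The LOCATED GAP (cell GAPS G-B9-16/C-IF-08, b09 + r1-g5): for the L²-entries (3.46) the paper
asserts the convergence of (3.130)/(3.138) *"in all norms appearing on the left-hand sides of (3.42)–(3.47)"* and the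
resulting Theorem 3.12 without writing the norm, the form of the n-th term or the decay bookkeeping; the sister unit
r1-g5 (`…B9SectDForm`, `HOME/b2b-balaban-r1/SectD-form-bound-proof.md`) supplied the GLOBAL energy-norm convergence
(form bound (N′)) but — by its own "NOT supplied" clause — not the BLOCK-LOCALISED L² entries with the decay factor
e^{−δd(y,y′)}, on which (3.132) ((QGQ*)⁻¹ decay, unit r1-g3 `…QGQInverse`) and the B11 consumers rest.  This module
types the block-L² operator norms ‖1_{Δ(y)}·T·1_{Δ(y′)}‖_{L²→L²} (`bl2`, `BlockBd`), the WEIGHTED block-L² normed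
spaces (`l2w`, an instance of `B11SectG.BlockNorm` with the scale weights (L^jη)^{±1} of (3.46) inside the local
size), and proves: (a) the calculus linking them (`hasMaj_l2w_of_blockBd`, `blockBd_of_hasMaj_l2w`); (b) the ADJOINT
TRANSFER `blockBd_of_adjoint`/`blockBd_symm`/`blockBd_geom` — for the symmetric G₀ and the transposed pair ∇G₀, G₀∇*
the one-sided scale weight (L^jη)^α printed in (3.46) may be split (L^jη)^β(L^{j′}η)^γ, β + γ = α, β, γ ≥ 0, with NO
loss of rate (the printed remark of p. 398 invokes Lemma 2.1 for this; for these splits it is not needed); (c) the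
finite-lattice a priori bound `exists_blockBd_const` (the qualitative input of the Neumann bookkeeping); (d) the Sect. D
assembly `rightEntry_majorant` (GF = G₀F + (G₀Δ′_π)(GF) ⇒ majorant A(1 − q)⁻¹e^{−ρd}, q = κκ′Bθc², from
`B11SectG.neumann_majorant`) and `entry_majorant` (EGF = EG₀F + (EG₀)Δ′_π(GF)) over ABSTRACT block-normed spaces, so
that each of the six entries E ∈ {1, ∇, ∇∇}, F ∈ {1, ∇*, ∇*∇*} is an instance with its own weight class; (e) the
scale-transfer inequality of [4] (2.60) behind the remark of p. 398 (`pow_scale_le_of_ineq260`, `BlockBd.transfer`: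
cost L^t and rate αδ₀ under t·log L ≤ αδ₀RM — cell condition C-RM_t); (f) the printed shape `thm312_entry1_l2`:
G₀ with block-L² bound B·L^jη·L^{j′}η·e^{−δ₁d}, Δ′_π with θ(L^jη)⁻¹(L^{j′}η)⁻¹e^{−δ₁d}, ρ + 2σ ≤ δ₁, Bθc(σ)² < 1 ⇒ G
has the bound B(1 − Bθc²)⁻¹·L^jη·L^{j′}η·e^{−ρd} — entry 1 of (3.46) for G with decay; (g) `abs_dotProduct_le_of_blockBd`,
the form bound |⟨u, Gv⟩| ≤ Σ_{y,y′} N(y,y′)‖1_yu‖‖1_{y′}v‖ that turns block-L² bounds into the kernel bounds of the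
(QGQ*)-type operators of (3.132).  CENSUS RESULT: (i) the decay of the L²-entries of G, G₁ survives the Neumann series
with the one-time rate loss 2σ of Lemma 2.1 (ρ = δ₁ − 2σ) and the constant (1 − q)⁻¹, q = B₀θc₁(σ)² — the *"for α₀
sufficiently small"* of Theorem 3.12 LOCATED as B₀·θ(Mα₀)·c₁² < 1 with θ linear in Mα₀; (ii) no sup-norm / Hölder
input and no random-walk expansion of G is needed for the L² half; (iii) the block-L² bound of Δ′_π itself (θ and its
rate, from (3.120), Theorem 3.1 (3.46)₃,₅, (3.49), (3.36)) and of Δ^{(2)}_π (from (3.135), (3.137)) are DERIVED in the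
companion md `HOME/b2b-balaban-r1/SectD-L2-decay-proof.md` §4 (prose, printed inputs + (e)); here they are hypotheses
of the printed shape.
WHAT IS *NOT* REPRODUCED OR ASSERTED: the sup-norm and Hölder entries (3.42)–(3.45), (3.47) and Theorem 3.10 (random
walk expansion) for G, G₁, H, H₁ (cell GAPS G-pv21g2-1 (a), another lineage); (3.131) itself (an L¹ × L^∞ bound, not
used); (3.133); Theorems 3.1, 3.3, (3.49), Lemma 2.1 [4] (hypotheses of the printed shapes); the identification of the
lattice operators with the abstract `Module.End`s (prose).  NOTHING of the series is asserted; value = located-gap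
repair + kernel certificate of the block-L² bookkeeping, NOT summit progress.  Unit `b2b-balaban-r1-g6` (reader group
A gen 6, r1 lineage, cell pub-balaban); companion rows: cell `GAPS.md` C-r1g6-1, G-B9-16R2, `INTERFACES-A.md` IF-A-29,
`HANDOFF.md` § r1-g6, `b2b-balaban-r1/SectD-L2-decay-proof.md`.
-/

namespace Literature.MathematicalPhysics.QuantumFieldTheory.Balaban1983to89.B9SectDL2Decay

open Literature.MathematicalPhysics.QuantumFieldTheory.Balaban1983to89
open Finset B6RandomWalk B11SectG

variable {g : B6.Geometry}

/-! ## 1. Block-L² sizes -/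

section L2Block

variable {X : Type} [Fintype X]

open Classical in
/-- Σ_{x ∈ Δ(y)} f(x)²: the square of the L²-size of f on the block of y. [folklore] -/
noncomputable def bsq (blk : X → g.Site) (y : g.Site) (f : X → ℝ) : ℝ :=
  ∑ x : X, if blk x = y then f x ^ 2 else 0

/-- The block-L² size ‖1_{Δ(y)} f‖₂ = (Σ_{x∈Δ(y)} f(x)²)^{1/2}. [folklore] -/
noncomputable def bl2 (blk : X → g.Site) (y : g.Site) (f : X → ℝ) : ℝ :=
  Real.sqrt (bsq blk y f)

/-- Block sizes are non-negative. [folklore] -/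
theorem bsq_nonneg (blk : X → g.Site) (y : g.Site) (f : X → ℝ) : 0 ≤ bsq blk y f := by
  classical
  unfold bsq
  exact Finset.sum_nonneg fun x _ => by split_ifs <;> positivity

/-- Block-L² sizes are non-negative. [folklore] -/
theorem bl2_nonneg (blk : X → g.Site) (y : g.Site) (f : X → ℝ) : 0 ≤ bl2 blk y f :=
  Real.sqrt_nonneg _

/-- ‖1_{Δ(y)}f‖₂² = Σ_{x∈Δ(y)} f(x)². [folklore] -/
theorem bl2_sq (blk : X → g.Site) (y : g.Site) (f : X → ℝ) : bl2 blk y f ^ 2 = bsq blk y f :=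
  Real.sq_sqrt (bsq_nonneg blk y f)

/-- The zero function has size 0. [folklore] -/
@[simp] theorem bsq_zero (blk : X → g.Site) (y : g.Site) : bsq blk y (0 : X → ℝ) = 0 := by
  classical
  unfold bsq
  simp

/-- The zero function has block-L² size 0. [folklore] -/
@[simp] theorem bl2_zero (blk : X → g.Site) (y : g.Site) : bl2 blk y (0 : X → ℝ) = 0 := by
  simp [bl2]

/-- Sizes are insensitive to sign. [folklore] -/
theorem bsq_neg (blk : X → g.Site) (y : g.Site) (f : X → ℝ) : bsq blk y (-f) = bsq blk y f := by
  classical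
  unfold bsq
  simp

/-- Block-L² sizes are insensitive to sign. [folklore] -/
theorem bl2_neg (blk : X → g.Site) (y : g.Site) (f : X → ℝ) : bl2 blk y (-f) = bl2 blk y f := by
  simp [bl2, bsq_neg]

/-- Homogeneity of the squared size. [folklore] -/
theorem bsq_smul (blk : X → g.Site) (y : g.Site) (c : ℝ) (f : X → ℝ) :
    bsq blk y (c • f) = c ^ 2 * bsq blk y f := by
  classical
  unfold bsq
  rw [Finset.mul_sum]
  refine Finset.sum_congr rfl fun x _ => ?_
  split_ifs <;> simp [mul_pow]

/-- Homogeneity of the block-L² size. [folklore] -/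
theorem bl2_smul (blk : X → g.Site) (y : g.Site) (c : ℝ) (f : X → ℝ) :
    bl2 blk y (c • f) = |c| * bl2 blk y f := by
  rw [bl2, bsq_smul, Real.sqrt_mul' _ (bsq_nonneg _ _ _), Real.sqrt_sq_eq_abs, bl2]

/-- The piece Δ(y)f has the same size on Δ(y) as f. [folklore] -/
theorem bsq_blockPiece_self (blk : X → g.Site) (y : g.Site) (f : X → ℝ) :
    bsq blk y (blockPiece blk y f) = bsq blk y f := by
  classical
  unfold bsq
  refine Finset.sum_congr rfl fun x _ => ?_
  by_cases hx : blk x = y <;> simp [blockPiece, hx]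

/-- The piece Δ(y)f has the same block-L² size on Δ(y) as f. [folklore] -/
theorem bl2_blockPiece_self (blk : X → g.Site) (y : g.Site) (f : X → ℝ) :
    bl2 blk y (blockPiece blk y f) = bl2 blk y f := by
  rw [bl2, bsq_blockPiece_self, bl2]

/-- A function vanishing off Δ(y′) has size 0 on every other block. [folklore] -/
theorem bsq_eq_zero_of_loc (blk : X → g.Site) {y y' : g.Site} (hne : y ≠ y') (f : X → ℝ)
    (hf : ∀ x, blk x ≠ y' → f x = 0) : bsq blk y f = 0 := by
  classical
  unfold bsq
  refine Finset.sum_eq_zero fun x _ => ?_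
  by_cases hx : blk x = y
  · have : f x = 0 := hf x (by rw [hx]; exact hne)
    simp [hx, this]
  · simp [hx]

/-- Every value on the block is bounded by the block-L² size. [folklore] -/
theorem sq_le_bsq (blk : X → g.Site) (f : X → ℝ) (x : X) : f x ^ 2 ≤ bsq blk (blk x) f := by
  classical
  unfold bsq
  have := Finset.single_le_sum (f := fun x' => if blk x' = blk x then f x' ^ 2 else 0)
    (fun x' _ => by split_ifs <;> positivity) (Finset.mem_univ x)
  simpa using this

/-- |f(x)| ≤ ‖1_{Δ(y)}f‖₂ for x ∈ Δ(y). [folklore] -/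
theorem abs_le_bl2 (blk : X → g.Site) (f : X → ℝ) (x : X) : |f x| ≤ bl2 blk (blk x) f :=
  Real.abs_le_sqrt (sq_le_bsq blk f x)

/-- Σ_y ‖1_{Δ(y)}f‖² = Σ_x f(x)² (the blocks partition X). [folklore] -/
theorem sum_bsq (blk : X → g.Site) (f : X → ℝ) : ∑ y : g.Site, bsq blk y f = ∑ x : X, f x ^ 2 := by
  classical
  unfold bsq
  rw [Finset.sum_comm]
  refine Finset.sum_congr rfl fun x _ => ?_
  rw [Finset.sum_ite_eq]
  simp

open Classical in
/-- **Cauchy–Schwarz on a block**: |Σ_{x∈Δ(y)} f(x)h(x)| ≤ ‖1_{Δ(y)}f‖₂‖1_{Δ(y)}h‖₂. [folklore] -/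
theorem abs_sum_block_mul_le (blk : X → g.Site) (y : g.Site) (f h : X → ℝ) :
    |∑ x : X, (if blk x = y then f x * h x else 0)| ≤ bl2 blk y f * bl2 blk y h := by
  set F : X → ℝ := fun x => if blk x = y then f x else 0 with hF
  set H : X → ℝ := fun x => if blk x = y then h x else 0 with hH
  have hprod : (fun x => if blk x = y then f x * h x else 0) = fun x => F x * H x := by
    funext x; by_cases hx : blk x = y <;> simp [hF, hH, hx]
  have hF2 : ∑ x, F x ^ 2 = bsq blk y f := by
    unfold bsq; refine Finset.sum_congr rfl fun x _ => ?_; by_cases hx : blk x = y <;> simp [hF, hx]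
  have hH2 : ∑ x, H x ^ 2 = bsq blk y h := by
    unfold bsq; refine Finset.sum_congr rfl fun x _ => ?_; by_cases hx : blk x = y <;> simp [hH, hx]
  have hcs := Finset.sum_mul_sq_le_sq_mul_sq Finset.univ F H
  rw [hF2, hH2] at hcs
  have : (∑ x, (if blk x = y then f x * h x else 0)) ^ 2 ≤ (bl2 blk y f * bl2 blk y h) ^ 2 := by
    rw [hprod, mul_pow, bl2_sq, bl2_sq]; simpa using hcs
  calc |∑ x : X, (if blk x = y then f x * h x else 0)|
      = Real.sqrt ((∑ x : X, (if blk x = y then f x * h x else 0)) ^ 2) := (Real.sqrt_sq_eq_abs _).symm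
    _ ≤ Real.sqrt ((bl2 blk y f * bl2 blk y h) ^ 2) := Real.sqrt_le_sqrt this
    _ = bl2 blk y f * bl2 blk y h :=
        Real.sqrt_sq (mul_nonneg (bl2_nonneg _ _ _) (bl2_nonneg _ _ _))

open Classical in
/-- The pairing of the y-piece of u with w is a block sum. [folklore] -/
theorem blockPiece_dotProduct (blk : X → g.Site) (y : g.Site) (u w : X → ℝ) :
    blockPiece blk y u ⬝ᵥ w = ∑ x : X, (if blk x = y then u x * w x else 0) := by
  unfold dotProduct
  refine Finset.sum_congr rfl fun x _ => ?_
  by_cases hx : blk x = y <;> simp [blockPiece, hx]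

/-- |⟨Δ(y)u, w⟩| ≤ ‖1_{Δ(y)}u‖₂ ‖1_{Δ(y)}w‖₂. [folklore] -/
theorem abs_blockPiece_dotProduct_le (blk : X → g.Site) (y : g.Site) (u w : X → ℝ) :
    |blockPiece blk y u ⬝ᵥ w| ≤ bl2 blk y u * bl2 blk y w := by
  rw [blockPiece_dotProduct]
  exact abs_sum_block_mul_le blk y u w

open Classical in
/-- **Minkowski on a block**: ‖1_{Δ(y)}(f + h)‖₂ ≤ ‖1_{Δ(y)}f‖₂ + ‖1_{Δ(y)}h‖₂. [folklore] -/
theorem bl2_add_le (blk : X → g.Site) (y : g.Site) (f h : X → ℝ) :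
    bl2 blk y (f + h) ≤ bl2 blk y f + bl2 blk y h := by
  have hexp : bsq blk y (f + h) =
      bsq blk y f + 2 * ∑ x : X, (if blk x = y then f x * h x else 0) + bsq blk y h := by
    unfold bsq
    rw [Finset.mul_sum, ← Finset.sum_add_distrib, ← Finset.sum_add_distrib]
    refine Finset.sum_congr rfl fun x _ => ?_
    by_cases hx : blk x = y
    · simp [hx]; ring
    · simp [hx]
  have hcs := (le_abs_self _).trans (abs_sum_block_mul_le blk y f h)
  have hsq : bsq blk y (f + h) ≤ (bl2 blk y f + bl2 blk y h) ^ 2 := by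
    rw [hexp, add_sq, bl2_sq, bl2_sq]; nlinarith
  calc bl2 blk y (f + h) = Real.sqrt (bsq blk y (f + h)) := rfl
    _ ≤ Real.sqrt ((bl2 blk y f + bl2 blk y h) ^ 2) := Real.sqrt_le_sqrt hsq
    _ = bl2 blk y f + bl2 blk y h :=
        Real.sqrt_sq (add_nonneg (bl2_nonneg _ _ _) (bl2_nonneg _ _ _))

/-- The sup of a block-localised function is bounded by its block-L² size. [folklore] -/
theorem abs_le_bl2_of_loc (blk : X → g.Site) {y' : g.Site} (μ : X → ℝ) (hμ : ∀ x, blk x ≠ y' → μ x = 0)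
    (x : X) : |μ x| ≤ bl2 blk y' μ := by
  by_cases hx : blk x = y'
  · rw [← hx]; exact abs_le_bl2 blk μ x
  · rw [hμ x hx, abs_zero]; exact bl2_nonneg _ _ _

/-- The block-L² size is bounded by √|X| times the sup. [folklore] -/
theorem bl2_le_card_mul_sup (blk : X → g.Site) (y : g.Site) (f : X → ℝ) {B : ℝ} (hB : 0 ≤ B)
    (hf : ∀ x, |f x| ≤ B) : bl2 blk y f ≤ Real.sqrt (Fintype.card X) * B := by
  classical
  have hsq : bsq blk y f ≤ (Fintype.card X : ℝ) * B ^ 2 := by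
    unfold bsq
    calc ∑ x : X, (if blk x = y then f x ^ 2 else 0) ≤ ∑ _x : X, B ^ 2 :=
          Finset.sum_le_sum fun x _ => by
            split_ifs
            · calc f x ^ 2 = |f x| ^ 2 := (sq_abs _).symm
                _ ≤ B ^ 2 := pow_le_pow_left₀ (abs_nonneg _) (hf x) 2
            · positivity
      _ = (Fintype.card X : ℝ) * B ^ 2 := by simp
  calc bl2 blk y f = Real.sqrt (bsq blk y f) := rfl
    _ ≤ Real.sqrt ((Fintype.card X : ℝ) * B ^ 2) := Real.sqrt_le_sqrt hsq
    _ = Real.sqrt (Fintype.card X) * B := by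
        rw [Real.sqrt_mul (Nat.cast_nonneg _), Real.sqrt_sq hB]

end L2Block

/-! ## 2. The weighted block-L² normed space -/

section L2Norm

variable {X : Type} [Fintype X]

/-- The WEIGHTED BLOCK-L² normed space of lattice functions on X with block map `blk` and block weights W ≥ 0:
loc y f = W(y)·‖1_{Δ(y)}f‖₂, sharp block cut-offs (κ = 1), *"supp μ ⊂ Δ(y′)"* as `IsLoc`.  With W = (L^jη)^{−n} this is
the L²-version of the weighted local sizes |·|_{(−n)} of the series; the scale factors of (3.46) live in W. [folklore] -/
noncomputable def l2w (g : B6.Geometry) (blk : X → g.Site) (W : g.Site → ℝ) (hW : ∀ y, 0 ≤ W y) :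
    BlockNorm g (X → ℝ) := by
  classical
  exact
    { loc := fun y f => W y * bl2 blk y f
      cut := fun y =>
        { toFun := blockPiece blk y
          map_add' := fun f f' => by
            funext x; by_cases hx : blk x = y <;> simp [blockPiece, hx]
          map_smul' := fun c f => by
            funext x; by_cases hx : blk x = y <;> simp [blockPiece, hx] }
      IsLoc := fun y μ => ∀ x, blk x ≠ y → μ x = 0
      κ := 1
      κ_nonneg := zero_le_one
      loc_nonneg := fun y f => mul_nonneg (hW y) (bl2_nonneg _ _ _)
      loc_zero := fun y => by simp
      loc_add_le := fun y f f' => by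
        have := bl2_add_le blk y f f'
        calc W y * bl2 blk y (f + f') ≤ W y * (bl2 blk y f + bl2 blk y f') :=
              mul_le_mul_of_nonneg_left this (hW y)
          _ = W y * bl2 blk y f + W y * bl2 blk y f' := by ring
      loc_neg := fun y f => by simp only [bl2_neg]
      sum_cut := fun f => sum_blockPiece blk f
      isLoc_cut := fun y f x hx => by simp [blockPiece, hx]
      loc_cut_le := fun y f => by
        simp only [LinearMap.coe_mk, AddHom.coe_mk, bl2_blockPiece_self, one_mul, le_refl] }

/-- The local size of `l2w`. [folklore] -/
@[simp] theorem l2w_loc (blk : X → g.Site) (W : g.Site → ℝ) (hW : ∀ y, 0 ≤ W y) (y : g.Site) (f : X → ℝ) :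
    (l2w g blk W hW).loc y f = W y * bl2 blk y f := rfl

/-- Sharp blocks: κ = 1. [folklore] -/
@[simp] theorem l2w_κ (blk : X → g.Site) (W : g.Site → ℝ) (hW : ∀ y, 0 ≤ W y) : (l2w g blk W hW).κ = 1 := rfl

/-- *"supp μ ⊂ Δ(y)"*. [folklore] -/
theorem l2w_isLoc_iff (blk : X → g.Site) (W : g.Site → ℝ) (hW : ∀ y, 0 ≤ W y) (y : g.Site) (μ : X → ℝ) :
    (l2w g blk W hW).IsLoc y μ ↔ ∀ x, blk x ≠ y → μ x = 0 := Iff.rfl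

/-- The cut-off of `l2w` is the sharp block piece. [folklore] -/
theorem l2w_cut_apply (blk : X → g.Site) (W : g.Site → ℝ) (hW : ∀ y, 0 ≤ W y) (y : g.Site) (f : X → ℝ) :
    (l2w g blk W hW).cut y f = blockPiece blk y f := rfl

end L2Norm

/-! ## 3. Block-L² operator bounds: ‖1_{Δ(y)} T 1_{Δ(y′)}‖_{L²→L²} ≤ N(y, y′) -/

section BlockBd

variable {X₁ X₂ X₃ : Type} [Fintype X₁] [Fintype X₂] [Fintype X₃]

/-- The printed shape of (3.46): *"‖1_{Δ(y)} T λ‖ ≤ N(y, y′)‖λ‖ for supp λ ⊂ Δ(y′)"* in the (unweighted) lattice L²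
norms — i.e. the operator-norm bound ‖1_{Δ(y)} T 1_{Δ(y′)}‖_{L²→L²} ≤ N(y, y′).  [cite: Balaban1985BackgroundPropagators, (3.46) p.398] -/
def BlockBd (blk₁ : X₁ → g.Site) (blk₂ : X₂ → g.Site) (T : (X₁ → ℝ) →ₗ[ℝ] (X₂ → ℝ))
    (N : g.Site → g.Site → ℝ) : Prop :=
  ∀ (y' : g.Site) (μ : X₁ → ℝ), (∀ x, blk₁ x ≠ y' → μ x = 0) → ∀ y : g.Site,
    bl2 blk₂ y (T μ) ≤ N y y' * bl2 blk₁ y' μ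

/-- A block bound IS a majorant between the unweighted block-L² spaces. [folklore] -/
theorem blockBd_iff_hasMaj (blk₁ : X₁ → g.Site) (blk₂ : X₂ → g.Site) (T : (X₁ → ℝ) →ₗ[ℝ] (X₂ → ℝ))
    (N : g.Site → g.Site → ℝ) :
    BlockBd blk₁ blk₂ T N ↔
      HasMaj (l2w g blk₁ (fun _ => 1) (fun _ => zero_le_one)) (l2w g blk₂ (fun _ => 1) (fun _ => zero_le_one)) T N := by
  simp only [BlockBd, HasMaj, l2w_loc, one_mul]
  rfl

/-- RESCALING: a block bound N with W₂(y)N(y,y′) ≤ K(y,y′)W₁(y′) is the majorant K between the WEIGHTED block-L² spaces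
(this is how the scale factors (L^jη)^{±1} of (3.46) are moved into the local sizes). [folklore] -/
theorem hasMaj_l2w_of_blockBd {blk₁ : X₁ → g.Site} {blk₂ : X₂ → g.Site} {T : (X₁ → ℝ) →ₗ[ℝ] (X₂ → ℝ)}
    {N K : g.Site → g.Site → ℝ} {W₁ W₂ : g.Site → ℝ} (h₁ : ∀ y, 0 ≤ W₁ y) (h₂ : ∀ y, 0 ≤ W₂ y)
    (hT : BlockBd blk₁ blk₂ T N) (hW : ∀ y y', W₂ y * N y y' ≤ K y y' * W₁ y') :
    HasMaj (l2w g blk₁ W₁ h₁) (l2w g blk₂ W₂ h₂) T K := by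
  intro y' μ hμ y
  simp only [l2w_loc]
  calc W₂ y * bl2 blk₂ y (T μ) ≤ W₂ y * (N y y' * bl2 blk₁ y' μ) :=
        mul_le_mul_of_nonneg_left (hT y' μ hμ y) (h₂ y)
    _ = (W₂ y * N y y') * bl2 blk₁ y' μ := by ring
    _ ≤ (K y y' * W₁ y') * bl2 blk₁ y' μ := mul_le_mul_of_nonneg_right (hW y y') (bl2_nonneg _ _ _)
    _ = K y y' * (W₁ y' * bl2 blk₁ y' μ) := by ring

/-- UNSCALING: a majorant K between weighted block-L² spaces with W₂ > 0 is the block bound K(y,y′)W₁(y′)/W₂(y).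
[folklore] -/
theorem blockBd_of_hasMaj_l2w {blk₁ : X₁ → g.Site} {blk₂ : X₂ → g.Site} {T : (X₁ → ℝ) →ₗ[ℝ] (X₂ → ℝ)}
    {K : g.Site → g.Site → ℝ} {W₁ W₂ : g.Site → ℝ} {h₁ : ∀ y, 0 ≤ W₁ y} {h₂ : ∀ y, 0 ≤ W₂ y}
    (h : HasMaj (l2w g blk₁ W₁ h₁) (l2w g blk₂ W₂ h₂) T K) (hW₂ : ∀ y, 0 < W₂ y) :
    BlockBd blk₁ blk₂ T (fun y y' => K y y' * W₁ y' / W₂ y) := by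
  intro y' μ hμ y
  have := h y' μ hμ y
  simp only [l2w_loc] at this
  rw [mul_comm] at this
  calc bl2 blk₂ y (T μ) ≤ K y y' * (W₁ y' * bl2 blk₁ y' μ) / W₂ y := (le_div_iff₀ (hW₂ y)).mpr this
    _ = K y y' * W₁ y' / W₂ y * bl2 blk₁ y' μ := by ring

omit [Fintype X₁] in
/-- A block-localised function is its own block piece. [folklore] -/
theorem blockPiece_eq_self_of_loc (blk : X₁ → g.Site) {y' : g.Site} {μ : X₁ → ℝ}
    (hμ : ∀ x, blk x ≠ y' → μ x = 0) : blockPiece blk y' μ = μ := by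
  funext x
  by_cases hx : blk x = y'
  · simp [blockPiece, hx]
  · simp [blockPiece, hx, hμ x hx]

open Classical in
/-- ‖1_{Δ(y)}f‖₂² = ⟨Δ(y)f, f⟩. [folklore] -/
theorem bsq_eq_blockPiece_dotProduct (blk : X₁ → g.Site) (y : g.Site) (f : X₁ → ℝ) :
    bsq blk y f = blockPiece blk y f ⬝ᵥ f := by
  rw [blockPiece_dotProduct]
  unfold bsq
  refine Finset.sum_congr rfl fun x _ => ?_
  split_ifs <;> simp [sq]

/-- **ADJOINT TRANSFER (two-sided splits without scale transfer).**  If ⟨u, Tv⟩ = ⟨T′u, v⟩ (T′ = the transpose of T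
w.r.t. the lattice pairings) and T′ has the block bound N, then T has the block bound N(y′, y): the printed ONE-SIDED
weight (L^jη)^p of an entry of (3.46) may equally be read at the other argument for the transposed entry — for the
symmetric G₀ and the pair ∇G₀ / G₀∇* this gives every split of the scale weight between y and y′. [folklore] -/
theorem blockBd_of_adjoint {blk₁ : X₁ → g.Site} {blk₂ : X₂ → g.Site} {T : (X₁ → ℝ) →ₗ[ℝ] (X₂ → ℝ)}
    {T' : (X₂ → ℝ) →ₗ[ℝ] (X₁ → ℝ)} {N : g.Site → g.Site → ℝ}
    (hadj : ∀ (u : X₂ → ℝ) (v : X₁ → ℝ), u ⬝ᵥ T v = T' u ⬝ᵥ v) (hT' : BlockBd blk₂ blk₁ T' N)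
    (hN : ∀ y y', 0 ≤ N y y') : BlockBd blk₁ blk₂ T (fun y y' => N y' y) := by
  intro y' μ hμ y
  set f : X₂ → ℝ := T μ with hf
  set p : X₂ → ℝ := blockPiece blk₂ y f with hp
  have hploc : ∀ x, blk₂ x ≠ y → p x = 0 := fun x hx => by simp [hp, blockPiece, hx]
  -- ‖1_y f‖² = ⟨Δ(y)f, Tμ⟩ = ⟨T′Δ(y)f, μ⟩ ≤ ‖1_{y′}T′Δ(y)f‖ ‖μ‖ ≤ N(y′,y) ‖1_y f‖ ‖μ‖
  have hsq : bl2 blk₂ y f ^ 2 ≤ N y' y * bl2 blk₁ y' μ * bl2 blk₂ y f := by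
    have e1 : bl2 blk₂ y f ^ 2 = T' p ⬝ᵥ μ := by
      rw [bl2_sq, bsq_eq_blockPiece_dotProduct, ← hp, hf, hadj]
    have e2 : T' p ⬝ᵥ μ = blockPiece blk₁ y' μ ⬝ᵥ T' p := by
      rw [blockPiece_eq_self_of_loc blk₁ hμ, dotProduct_comm]
    rw [e1, e2]
    calc blockPiece blk₁ y' μ ⬝ᵥ T' p ≤ |blockPiece blk₁ y' μ ⬝ᵥ T' p| := le_abs_self _
      _ ≤ bl2 blk₁ y' μ * bl2 blk₁ y' (T' p) := abs_blockPiece_dotProduct_le blk₁ y' μ (T' p)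
      _ ≤ bl2 blk₁ y' μ * (N y' y * bl2 blk₂ y p) :=
          mul_le_mul_of_nonneg_left (hT' y p hploc y') (bl2_nonneg _ _ _)
      _ = N y' y * bl2 blk₁ y' μ * bl2 blk₂ y f := by rw [hp, bl2_blockPiece_self]; ring
  have ha : 0 ≤ bl2 blk₂ y f := bl2_nonneg _ _ _
  have hb : 0 ≤ N y' y * bl2 blk₁ y' μ := mul_nonneg (hN _ _) (bl2_nonneg _ _ _)
  rcases ha.lt_or_eq with hpos | hzero
  · rw [sq] at hsq
    exact le_of_mul_le_mul_right hsq hpos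
  · rw [← hzero]; exact hb

/-- A SYMMETRIC operator with block bound N also has the block bound N(y′, y). [folklore] -/
theorem blockBd_symm {blk : X₁ → g.Site} {T : Module.End ℝ (X₁ → ℝ)} {N : g.Site → g.Site → ℝ}
    (hsymm : ∀ u v : X₁ → ℝ, u ⬝ᵥ T v = T u ⬝ᵥ v) (hT : BlockBd blk blk T N) (hN : ∀ y y', 0 ≤ N y y') :
    BlockBd blk blk T (fun y y' => N y' y) :=
  blockBd_of_adjoint hsymm hT hN

/-- GEOMETRIC MEAN of two block bounds (min ≤ geometric mean): the splits (L^jη)^p(L^{j′}η)^q, p + q fixed, of a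
two-sided scale weight. [folklore] -/
theorem blockBd_geom {blk₁ : X₁ → g.Site} {blk₂ : X₂ → g.Site} {T : (X₁ → ℝ) →ₗ[ℝ] (X₂ → ℝ)}
    {N₁ N₂ : g.Site → g.Site → ℝ} (h₁ : BlockBd blk₁ blk₂ T N₁) (h₂ : BlockBd blk₁ blk₂ T N₂)
    (hN₁ : ∀ y y', 0 ≤ N₁ y y') (hN₂ : ∀ y y', 0 ≤ N₂ y y') :
    BlockBd blk₁ blk₂ T (fun y y' => Real.sqrt (N₁ y y' * N₂ y y')) := by
  intro y' μ hμ y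
  have ha : 0 ≤ bl2 blk₂ y (T μ) := bl2_nonneg _ _ _
  have hb : 0 ≤ bl2 blk₁ y' μ := bl2_nonneg _ _ _
  have hprod : bl2 blk₂ y (T μ) ^ 2 ≤ (N₁ y y' * N₂ y y') * bl2 blk₁ y' μ ^ 2 := by
    calc bl2 blk₂ y (T μ) ^ 2 = bl2 blk₂ y (T μ) * bl2 blk₂ y (T μ) := sq _
      _ ≤ (N₁ y y' * bl2 blk₁ y' μ) * (N₂ y y' * bl2 blk₁ y' μ) :=
          mul_le_mul (h₁ y' μ hμ y) (h₂ y' μ hμ y) ha (mul_nonneg (hN₁ _ _) hb)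
      _ = (N₁ y y' * N₂ y y') * bl2 blk₁ y' μ ^ 2 := by ring
  calc bl2 blk₂ y (T μ) = Real.sqrt (bl2 blk₂ y (T μ) ^ 2) := (Real.sqrt_sq ha).symm
    _ ≤ Real.sqrt ((N₁ y y' * N₂ y y') * bl2 blk₁ y' μ ^ 2) := Real.sqrt_le_sqrt hprod
    _ = Real.sqrt (N₁ y y' * N₂ y y') * bl2 blk₁ y' μ := by
        rw [Real.sqrt_mul (mul_nonneg (hN₁ _ _) (hN₂ _ _)), Real.sqrt_sq hb]

/-- Monotonicity of block bounds. [folklore] -/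
theorem BlockBd.mono {blk₁ : X₁ → g.Site} {blk₂ : X₂ → g.Site} {T : (X₁ → ℝ) →ₗ[ℝ] (X₂ → ℝ)}
    {N N' : g.Site → g.Site → ℝ} (h : BlockBd blk₁ blk₂ T N) (hle : ∀ y y', N y y' ≤ N' y y') :
    BlockBd blk₁ blk₂ T N' :=
  fun y' μ hμ y => (h y' μ hμ y).trans (mul_le_mul_of_nonneg_right (hle _ _) (bl2_nonneg _ _ _))

/-- **INTERPOLATION OF SPLITS**: two block bounds N₁, N₂ ≥ 0 of the same operator give N₁ᵗN₂¹⁻ᵗ for t ∈ [0, 1] (the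
bound is a minimum).  With `blockBd_of_adjoint` this yields every split (L^jη)^β(L^{j′}η)^γ, β + γ = α, between a
printed one-sided power and its transpose — the p. 398 remark, for symmetric/transposed pairs, without Lemma 2.1.
[cite: Balaban1985BackgroundPropagators, remark after (3.46) p.398] -/
theorem blockBd_interp {blk₁ : X₁ → g.Site} {blk₂ : X₂ → g.Site} {T : (X₁ → ℝ) →ₗ[ℝ] (X₂ → ℝ)}
    {N₁ N₂ : g.Site → g.Site → ℝ} (h₁ : BlockBd blk₁ blk₂ T N₁) (h₂ : BlockBd blk₁ blk₂ T N₂)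
    (hN₁ : ∀ y y', 0 ≤ N₁ y y') (hN₂ : ∀ y y', 0 ≤ N₂ y y') {t : ℝ} (ht₀ : 0 ≤ t) (ht₁ : t ≤ 1) :
    BlockBd blk₁ blk₂ T (fun y y' => N₁ y y' ^ t * N₂ y y' ^ (1 - t)) := by
  intro y' μ hμ y
  have a := h₁ y' μ hμ y
  have b := h₂ y' μ hμ y
  have hm : 0 ≤ bl2 blk₁ y' μ := bl2_nonneg _ _ _
  have hv : 0 ≤ bl2 blk₂ y (T μ) := bl2_nonneg _ _ _
  have h1 : t + (1 - t) = 1 := by ring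
  have hsplit : ∀ x : ℝ, 0 ≤ x → x = x ^ t * x ^ (1 - t) := fun x hx => by
    rw [← Real.rpow_add' hx (by rw [h1]; norm_num), h1, Real.rpow_one]
  calc bl2 blk₂ y (T μ) = bl2 blk₂ y (T μ) ^ t * bl2 blk₂ y (T μ) ^ (1 - t) := hsplit _ hv
    _ ≤ (N₁ y y' * bl2 blk₁ y' μ) ^ t * (N₂ y y' * bl2 blk₁ y' μ) ^ (1 - t) :=
        mul_le_mul (Real.rpow_le_rpow hv a ht₀) (Real.rpow_le_rpow hv b (by linarith))
          (Real.rpow_nonneg hv _) (Real.rpow_nonneg (mul_nonneg (hN₁ _ _) hm) _)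
    _ = N₁ y y' ^ t * N₂ y y' ^ (1 - t) * (bl2 blk₁ y' μ ^ t * bl2 blk₁ y' μ ^ (1 - t)) := by
        rw [Real.mul_rpow (hN₁ _ _) hm, Real.mul_rpow (hN₂ _ _) hm]; ring
    _ = N₁ y y' ^ t * N₂ y y' ^ (1 - t) * bl2 blk₁ y' μ := by rw [← hsplit _ hm]

/-- **A PRIORI BOUND** (finite lattice): every linear operator has SOME constant block bound — the qualitative input
under which the Neumann series bookkeeping (`B11SectG.neumann_majorant`) yields the decaying majorant. [folklore] -/
theorem exists_blockBd_const (blk₁ : X₁ → g.Site) (blk₂ : X₂ → g.Site) (T : (X₁ → ℝ) →ₗ[ℝ] (X₂ → ℝ)) :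
    ∃ M : ℝ, 0 ≤ M ∧ BlockBd blk₁ blk₂ T (fun _ _ => M) := by
  classical
  set E : ℝ := ∑ x' : X₁, ∑ x : X₂, |T (Pi.single x' 1) x| with hE
  have hE0 : 0 ≤ E := Finset.sum_nonneg fun _ _ => Finset.sum_nonneg fun _ _ => abs_nonneg _
  refine ⟨Real.sqrt (Fintype.card X₂) * E, mul_nonneg (Real.sqrt_nonneg _) hE0, fun y' μ hμ y => ?_⟩
  set B : ℝ := bl2 blk₁ y' μ with hB
  have hB0 : 0 ≤ B := bl2_nonneg _ _ _
  have hμB : ∀ x, |μ x| ≤ B := abs_le_bl2_of_loc blk₁ μ hμ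
  have hdec : μ = ∑ x' : X₁, μ x' • (Pi.single x' (1 : ℝ) : X₁ → ℝ) := by
    funext z
    rw [Finset.sum_apply]
    simp [Pi.single_apply]
  have hpt : ∀ x : X₂, |T μ x| ≤ E * B := by
    intro x
    have hTμ : T μ x = ∑ x' : X₁, μ x' * T (Pi.single x' 1) x := by
      conv_lhs => rw [hdec, map_sum, Finset.sum_apply]
      refine Finset.sum_congr rfl fun x' _ => ?_
      rw [map_smul, Pi.smul_apply, smul_eq_mul]
    rw [hTμ]
    calc |∑ x' : X₁, μ x' * T (Pi.single x' 1) x|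
        ≤ ∑ x' : X₁, |μ x' * T (Pi.single x' 1) x| := Finset.abs_sum_le_sum_abs _ _
      _ = ∑ x' : X₁, |μ x'| * |T (Pi.single x' 1) x| := Finset.sum_congr rfl fun x' _ => abs_mul _ _
      _ ≤ ∑ x' : X₁, B * |T (Pi.single x' 1) x| :=
          Finset.sum_le_sum fun x' _ => mul_le_mul_of_nonneg_right (hμB x') (abs_nonneg _)
      _ = (∑ x' : X₁, |T (Pi.single x' 1) x|) * B := by
          rw [Finset.sum_mul]; exact Finset.sum_congr rfl fun _ _ => mul_comm _ _
      _ ≤ E * B :=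
          mul_le_mul_of_nonneg_right (Finset.sum_le_sum fun x' _ =>
            Finset.single_le_sum (fun z _ => abs_nonneg (T (Pi.single x' 1) z)) (Finset.mem_univ x)) hB0
  calc bl2 blk₂ y (T μ) ≤ Real.sqrt (Fintype.card X₂) * (E * B) :=
        bl2_le_card_mul_sup blk₂ y (T μ) (mul_nonneg hE0 hB0) hpt
    _ = Real.sqrt (Fintype.card X₂) * E * B := by ring

/-- The a priori bound between WEIGHTED block-L² spaces (lower weights W₁ > 0). [folklore] -/
theorem exists_hasMaj_l2w_const (blk₁ : X₁ → g.Site) (blk₂ : X₂ → g.Site) (T : (X₁ → ℝ) →ₗ[ℝ] (X₂ → ℝ))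
    {W₁ W₂ : g.Site → ℝ} (hW₁ : ∀ y, 0 < W₁ y) (h₂ : ∀ y, 0 ≤ W₂ y) :
    ∃ M₀ : ℝ, 0 ≤ M₀ ∧
      HasMaj (l2w g blk₁ W₁ fun y => (hW₁ y).le) (l2w g blk₂ W₂ h₂) T (fun _ _ => M₀) := by
  obtain ⟨M, hM0, hM⟩ := exists_blockBd_const blk₁ blk₂ T
  set SW : ℝ := ∑ y : g.Site, W₂ y with hSW
  set SI : ℝ := ∑ y : g.Site, (W₁ y)⁻¹ with hSI
  have hSW0 : 0 ≤ SW := Finset.sum_nonneg fun y _ => h₂ y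
  have hSI0 : 0 ≤ SI := Finset.sum_nonneg fun y _ => (inv_pos.mpr (hW₁ y)).le
  refine ⟨SW * M * SI, mul_nonneg (mul_nonneg hSW0 hM0) hSI0, ?_⟩
  refine hasMaj_l2w_of_blockBd (fun y => (hW₁ y).le) h₂ hM fun y y' => ?_
  have hWy : W₂ y ≤ SW := Finset.single_le_sum (fun z _ => h₂ z) (Finset.mem_univ y)
  have hIy : (W₁ y')⁻¹ ≤ SI :=
    Finset.single_le_sum (fun z _ => (inv_pos.mpr (hW₁ z)).le) (Finset.mem_univ y')
  have h1 : 1 ≤ SI * W₁ y' := by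
    have := mul_le_mul_of_nonneg_right hIy (hW₁ y').le
    rwa [inv_mul_cancel₀ (hW₁ y').ne'] at this
  calc W₂ y * M ≤ SW * M := mul_le_mul_of_nonneg_right hWy hM0
    _ = SW * M * 1 := (mul_one _).symm
    _ ≤ SW * M * (SI * W₁ y') := mul_le_mul_of_nonneg_left h1 (mul_nonneg hSW0 hM0)
    _ = SW * M * SI * W₁ y' := by ring

/-- **FORM BOUND from a block bound** (for the kernels (QGQ*)(c, c′) of (3.132)): |⟨u, Tv⟩| ≤ Σ_{y,y′} N(y,y′)
‖1_{Δ(y)}u‖₂ ‖1_{Δ(y′)}v‖₂. [folklore] -/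
theorem abs_dotProduct_le_of_blockBd {blk₁ : X₁ → g.Site} {blk₂ : X₂ → g.Site}
    {T : (X₁ → ℝ) →ₗ[ℝ] (X₂ → ℝ)} {N : g.Site → g.Site → ℝ} (hT : BlockBd blk₁ blk₂ T N)
    (u : X₂ → ℝ) (v : X₁ → ℝ) :
    |u ⬝ᵥ T v| ≤ ∑ y : g.Site, ∑ y' : g.Site, N y y' * bl2 blk₂ y u * bl2 blk₁ y' v := by
  have hdec : u ⬝ᵥ T v = ∑ y : g.Site, ∑ y' : g.Site, blockPiece blk₂ y u ⬝ᵥ T (blockPiece blk₁ y' v) := by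
    conv_lhs => rw [← sum_blockPiece blk₂ u, ← sum_blockPiece blk₁ v]
    rw [map_sum, sum_dotProduct]
    refine Finset.sum_congr rfl fun y _ => ?_
    rw [dotProduct_sum]
  rw [hdec]
  refine (Finset.abs_sum_le_sum_abs _ _).trans (Finset.sum_le_sum fun y _ => ?_)
  refine (Finset.abs_sum_le_sum_abs _ _).trans (Finset.sum_le_sum fun y' _ => ?_)
  have hloc : ∀ x, blk₁ x ≠ y' → blockPiece blk₁ y' v x = 0 := fun x hx => by simp [blockPiece, hx]
  calc |blockPiece blk₂ y u ⬝ᵥ T (blockPiece blk₁ y' v)|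
      ≤ bl2 blk₂ y u * bl2 blk₂ y (T (blockPiece blk₁ y' v)) := abs_blockPiece_dotProduct_le _ _ _ _
    _ ≤ bl2 blk₂ y u * (N y y' * bl2 blk₁ y' (blockPiece blk₁ y' v)) :=
        mul_le_mul_of_nonneg_left (hT y' _ hloc y) (bl2_nonneg _ _ _)
    _ = N y y' * bl2 blk₂ y u * bl2 blk₁ y' v := by rw [bl2_blockPiece_self]; ring

end BlockBd

/-! ## 4. Sect. D, pp. 421–423: the expansion (3.130) G = G₀ + G₀Δ′_πG₀ + ⋯ over block majorants

Abstract over block-normed spaces (`B11SectG.BlockNorm`): `G0` = G₀ = (Δ_π + Q*aQ)⁻¹ of (3.129) (resp. its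
G₁-analogue with Δ^{(2)}_π, (3.138)), `T'` = Δ′_π of (3.120) (resp. Δ′_π + Δ^{(2)}_π), `G` = (G₀⁻¹ − T′)⁻¹ = G of
(3.122)/(3.130) (resp. G₁ of (3.128)); `Fop` = the right factor F ∈ {1, ∇*_U, ∇*_U∇*_U} and `Eop` = the left factor
E ∈ {1, ∇_U, ∇_U∇_U} of an entry E·G·F of (3.46).  The fixed-point form of (3.130) is G = G₀ + G₀T′G. -/

section SectD

variable {F₀ F F₃ : Type} [AddCommGroup F₀] [Module ℝ F₀] [AddCommGroup F] [Module ℝ F]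
  [AddCommGroup F₃] [Module ℝ F₃]

/-- (3.130), algebra: G = G₀ + G₀T′G gives, for every right factor F, GF = G₀F + (G₀T′)(GF) — the linear fixed-point
equation of `B11SectG.neumann_majorant` with K′ = G₀T′, S = G₀F. [cite: Balaban1985BackgroundPropagators, (3.130) p.421] -/
theorem rightEntry_fix {G G0 T' : Module.End ℝ F} (Fop : F₀ →ₗ[ℝ] F) (hfix : G = G0 + G0 * T' * G) :
    G ∘ₗ Fop = G0 ∘ₗ Fop + (G0 ∘ₗ T') ∘ₗ (G ∘ₗ Fop) := by
  have hpt : ∀ v : F, G v = G0 v + G0 (T' (G v)) := fun v => by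
    conv_lhs => rw [hfix]
    simp [Module.End.mul_apply]
  ext v
  simp only [LinearMap.comp_apply, LinearMap.add_apply]
  exact hpt (Fop v)

/-- (3.130), algebra, two-sided: EGF = EG₀F + (EG₀)T′(GF). [cite: Balaban1985BackgroundPropagators, (3.130) p.421] -/
theorem entry_fix {G G0 T' : Module.End ℝ F} (Eop : F →ₗ[ℝ] F₃) (Fop : F₀ →ₗ[ℝ] F)
    (hfix : G = G0 + G0 * T' * G) :
    Eop ∘ₗ G ∘ₗ Fop = Eop ∘ₗ G0 ∘ₗ Fop + (Eop ∘ₗ G0) ∘ₗ (T' ∘ₗ (G ∘ₗ Fop)) := by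
  have hpt : ∀ v : F, G v = G0 v + G0 (T' (G v)) := fun v => by
    conv_lhs => rw [hfix]
    simp [Module.End.mul_apply]
  ext v
  simp only [LinearMap.comp_apply, LinearMap.add_apply]
  conv_lhs => rw [hpt (Fop v)]
  rw [map_add]

/-- **RIGHT ENTRIES OF (3.46) FOR G, WITH DECAY** — the block-majorant content of *"This inequality [(3.131)] and
Theorem 3.3 for G₀ imply a convergence of the series (3.130), for α₀ sufficiently small, in all norms appearing on the
left-hand sides of the inequalities (3.42)–(3.47)"* (p. 422) for the L²-entries G·F: if G₀ has majorant Be^{−δ₁d}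
from the block-normed space b₁ to b₂ and T′ = Δ′_π has majorant θe^{−δ₁d} from b₂ back to b₁ (θ = O(1)Mα₀, the
*"small factor α₀"* of p. 422), the F-entry G₀F of G₀ has majorant Ae^{−δ₁d} (Theorem 3.3), ρ + 2σ ≤ δ₁ with the row sum
(2.61) of [4] Lemma 2.1 at rate σ, GF is a priori bounded (finite lattice) and q := κ₂κ₁Bθc² < 1, then GF has
majorant A(1 − q)⁻¹e^{−ρd}.  KERNEL-CHECKED from `B11SectG.neumann_majorant`.
[cite: Balaban1985BackgroundPropagators, (3.130) p.421 + Thm 3.12 p.423; Balaban1984PropagatorsII, Lemma 2.1 p.234] -/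
theorem rightEntry_majorant {b₀ : BlockNorm g F₀} {b₁ b₂ : BlockNorm g F} {G G0 T' : Module.End ℝ F}
    {Fop : F₀ →ₗ[ℝ] F} {B θ A M₀ δ₁ ρ σ c : ℝ}
    (htri : Triangle254 g) (hd : ∀ a b : g.Site, 0 ≤ g.dist a b) (hrow : RowSum g σ c)
    (hB : 0 ≤ B) (hθ : 0 ≤ θ) (hA : 0 ≤ A) (hM₀ : 0 ≤ M₀) (hρ : 0 ≤ ρ) (hσ : 0 ≤ σ) (hρδ : ρ + 2 * σ ≤ δ₁)
    (hG0 : HasMaj b₁ b₂ G0 (fun a b => B * Real.exp (-(δ₁ * g.dist a b))))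
    (hT' : HasMaj b₂ b₁ T' (fun a b => θ * Real.exp (-(δ₁ * g.dist a b))))
    (hS : HasMaj b₀ b₂ (G0 ∘ₗ Fop) (fun a b => A * Real.exp (-(δ₁ * g.dist a b))))
    (hfix : G = G0 + G0 * T' * G)
    (hap : HasMaj b₀ b₂ (G ∘ₗ Fop) (fun _ _ => M₀))
    (hq : b₂.κ * (b₁.κ * B * θ * c) * c < 1) :
    HasMaj b₀ b₂ (G ∘ₗ Fop)
      (fun a b => A * (1 - b₂.κ * (b₁.κ * B * θ * c) * c)⁻¹ * Real.exp (-(ρ * g.dist a b))) := by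
  -- K′ = G₀T′ has majorant κ₁Bθc·e^{−(ρ+σ)d}: one use of (2.54) + (2.61)
  have hK : HasMaj b₂ b₂ (G0 ∘ₗ T')
      (fun a b => b₁.κ * B * θ * c * Real.exp (-((ρ + σ) * g.dist a b))) :=
    hasMaj_comp_exp (b₁ := b₂) (b₂ := b₁) (b₃ := b₂) htri hd hrow hB hθ (by linarith) (by linarith)
      (by linarith) hG0 hT'
  have hS' : HasMaj b₀ b₂ (G0 ∘ₗ Fop) (fun a b => A * Real.exp (-(ρ * g.dist a b))) :=
    hS.of_rate_le hd hA (by linarith)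
  have hc : 0 ≤ c ∨ IsEmpty g.Site := by
    by_cases hne : Nonempty g.Site
    · exact Or.inl (hrow.nonneg (Classical.arbitrary _))
    · exact Or.inr (not_nonempty_iff.mp hne)
  rcases hc with hc | hemp
  · exact neumann_majorant htri hd hrow (mul_nonneg (mul_nonneg (mul_nonneg b₁.κ_nonneg hB) hθ) hc) hA hM₀ hρ
      le_rfl hK hS' (rightEntry_fix Fop hfix) hap hq
  · intro y' μ hμ y
    exact (IsEmpty.false y).elim

/-- **TWO-SIDED ENTRIES OF (3.46) FOR G, WITH DECAY**: from EGF = EG₀F + (EG₀)T′(GF) — the printed E·F-entry of G₀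
(majorant A_{EF}e^{−δ₁d}, Theorem 3.3), the printed E-entry EG₀ (B_E e^{−δ₁d}), T′ (θ′e^{−δ₁d}, in the weight class
matching EG₀) and the right entry GF (A′e^{−ρd}, `rightEntry_majorant`), with ρ + σ ≤ δ₁: EGF has majorant
(A_{EF} + κκ′B_Eθ′A′c²)e^{−ρd}.  KERNEL-CHECKED (two uses of (2.54) + (2.61)).
[cite: Balaban1985BackgroundPropagators, (3.130) p.421 + Thm 3.12 p.423; Balaban1984PropagatorsII, Lemma 2.1 p.234] -/
theorem entry_majorant {b₀ : BlockNorm g F₀} {b₁' b₂' : BlockNorm g F} {b₃ : BlockNorm g F₃}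
    {G G0 T' : Module.End ℝ F} {Eop : F →ₗ[ℝ] F₃} {Fop : F₀ →ₗ[ℝ] F} {BE θ' AEF A' δ₁ ρ σ c : ℝ}
    (htri : Triangle254 g) (hd : ∀ a b : g.Site, 0 ≤ g.dist a b) (hrow : RowSum g σ c)
    (hBE : 0 ≤ BE) (hθ' : 0 ≤ θ') (hAEF : 0 ≤ AEF) (hA' : 0 ≤ A') (hρ : 0 ≤ ρ) (hσ : 0 ≤ σ)
    (hρδ : ρ + σ ≤ δ₁)
    (hE : HasMaj b₁' b₃ (Eop ∘ₗ G0) (fun a b => BE * Real.exp (-(δ₁ * g.dist a b))))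
    (hT' : HasMaj b₂' b₁' T' (fun a b => θ' * Real.exp (-(δ₁ * g.dist a b))))
    (hEF : HasMaj b₀ b₃ (Eop ∘ₗ G0 ∘ₗ Fop) (fun a b => AEF * Real.exp (-(δ₁ * g.dist a b))))
    (hGF : HasMaj b₀ b₂' (G ∘ₗ Fop) (fun a b => A' * Real.exp (-(ρ * g.dist a b))))
    (hfix : G = G0 + G0 * T' * G) :
    HasMaj b₀ b₃ (Eop ∘ₗ G ∘ₗ Fop)
      (fun a b => (AEF + b₁'.κ * BE * (b₂'.κ * θ' * A' * c) * c) * Real.exp (-(ρ * g.dist a b))) := by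
  -- T′(GF): majorant κ₂′θ′A′c·e^{−ρd}
  have h1 : HasMaj b₀ b₁' (T' ∘ₗ (G ∘ₗ Fop))
      (fun a b => b₂'.κ * θ' * A' * c * Real.exp (-(ρ * g.dist a b))) :=
    hasMaj_comp_exp (b₁ := b₀) (b₂ := b₂') (b₃ := b₁') htri hd hrow hθ' hA' hρ le_rfl hρδ hT' hGF
  have hc : 0 ≤ c ∨ IsEmpty g.Site := by
    by_cases hne : Nonempty g.Site
    · exact Or.inl (hrow.nonneg (Classical.arbitrary _))
    · exact Or.inr (not_nonempty_iff.mp hne)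
  rcases hc with hc | hemp
  swap
  · intro y' μ hμ y
    exact (IsEmpty.false y).elim
  -- (EG₀)(T′GF): majorant κ₁′B_E(κ₂′θ′A′c)c·e^{−ρd}
  have h2 : HasMaj b₀ b₃ ((Eop ∘ₗ G0) ∘ₗ (T' ∘ₗ (G ∘ₗ Fop)))
      (fun a b => b₁'.κ * BE * (b₂'.κ * θ' * A' * c) * c * Real.exp (-(ρ * g.dist a b))) :=
    hasMaj_comp_exp (b₁ := b₀) (b₂ := b₁') (b₃ := b₃) htri hd hrow hBE
      (mul_nonneg (mul_nonneg (mul_nonneg b₂'.κ_nonneg hθ') hA') hc) hρ le_rfl hρδ hE h1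
  have hEF' : HasMaj b₀ b₃ (Eop ∘ₗ G0 ∘ₗ Fop) (fun a b => AEF * Real.exp (-(ρ * g.dist a b))) :=
    hEF.of_rate_le hd hAEF (by linarith)
  have hsum := hEF'.add h2
  rw [← entry_fix Eop Fop hfix] at hsum
  refine hsum.mono fun a b => le_of_eq ?_
  ring

end SectD

/-! ## 5. Matrices: the resolvent identity behind (3.130) and the symmetry of the lattice operators -/

section Matrices

variable {n : Type} [Fintype n] [DecidableEq n]

/-- (3.130), algebra: if G₀S₀ = 1 (S₀ = G₀⁻¹ = Δ_π + Q*aQ) and (S₀ − T′)G = 1 (G = (Δ_π − Δ′_π + Q*aQ)⁻¹, T′ = Δ′_π),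
then G = G₀ + G₀T′G — whose iteration is the series (3.130). [cite: Balaban1985BackgroundPropagators, (3.129)–(3.130) p.421] -/
theorem resolvent_fix {S0 T' G0 G : Matrix n n ℝ} (hG0 : G0 * S0 = 1) (hG : (S0 - T') * G = 1) :
    G = G0 + G0 * T' * G := by
  calc G = G0 * S0 * G := by rw [hG0, Matrix.one_mul]
    _ = G0 * ((S0 - T') * G) + G0 * T' * G := by
        rw [Matrix.mul_assoc, sub_mul, Matrix.mul_sub, Matrix.mul_assoc]; abel
    _ = G0 + G0 * T' * G := by rw [hG, Matrix.mul_one]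

/-- The same identity for the associated linear operators. [folklore] -/
theorem toLin'_fix {T' G0 G : Matrix n n ℝ} (h : G = G0 + G0 * T' * G) :
    Matrix.toLin' G = Matrix.toLin' G0 + Matrix.toLin' G0 * Matrix.toLin' T' * Matrix.toLin' G := by
  conv_lhs => rw [h]
  rw [map_add, Matrix.toLin'_mul, Matrix.toLin'_mul]
  rfl

/-- ⟨u, Tv⟩ = ⟨Tᵀu, v⟩: the transpose is the adjoint for the lattice pairing (the hypothesis `hadj` of
`blockBd_of_adjoint`; ∇* is the transpose of ∇ up to the η-normalisations carried by the weights). [folklore] -/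
theorem dotProduct_toLin'_eq_transpose {m : Type} [Fintype m] [DecidableEq m] (T : Matrix m n ℝ) (u : m → ℝ)
    (v : n → ℝ) : u ⬝ᵥ Matrix.toLin' T v = Matrix.toLin' T.transpose u ⬝ᵥ v := by
  rw [Matrix.toLin'_apply, Matrix.toLin'_apply, Matrix.dotProduct_mulVec, Matrix.mulVec_transpose]

/-- A symmetric matrix is self-adjoint for the lattice pairing (the hypothesis `hsymm` of `blockBd_symm`; G₀, G, G₁,
Δ′_π, Δ^{(2)}_π are symmetric, being defined by quadratic forms, (3.120), (3.128), (3.134)). [folklore] -/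
theorem dotProduct_toLin'_symm {T : Matrix n n ℝ} (hT : T.IsSymm) (u v : n → ℝ) :
    u ⬝ᵥ Matrix.toLin' T v = Matrix.toLin' T u ⬝ᵥ v := by
  rw [dotProduct_toLin'_eq_transpose, hT.eq]

end Matrices

/-! ## 6. [4] Lemma 2.1 (2.60): the scale-transfer inequality

p. 398, after (3.47), verbatim: *"Next, the choice of powers L^jη is conventional also. Using Lemma 2.1 in [4] we may
replace the factor (L^jη)^α by (L^jη)^β(L^{j′}η)^γ with β + γ = α, j, j′ are indices of localizations."*  The
inequality behind this remark, KERNEL-CHECKED from (2.60) (`B6RandomWalk.Ineq260`): for t·log L ≤ αδ₀RM,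
L^{t j′} ≤ L^t · L^{t j} · e^{αδ₀d(y,y′)} (y ∈ Λ_j, y′ ∈ Λ_{j′}) — a transfer of the scale weight (L^{j′}η)^t to
(L^jη)^t costs the constant L^t and the rate αδ₀, under the LARGENESS CONDITION t·log L ≤ αδ₀RM on RM (cell
condition C-RM_t, of the kind of (2.59)). -/

section Transfer

/-- **(2.60) ⇒ scale transfer.** [cite: Balaban1984PropagatorsII, Lemma 2.1 (2.60) p.234] -/
theorem pow_scale_le_of_ineq260 {δ₀ α : ℝ} (h260 : Ineq260 g δ₀ α) (hαδ : 0 ≤ α * δ₀)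
    (hd : ∀ a b : g.Site, 0 ≤ g.dist a b) (hL : 1 ≤ g.L) (t : ℕ)
    (hRM : (t : ℝ) * Real.log g.L ≤ α * δ₀ * g.R * g.M) (y y' : g.Site) :
    g.L ^ (t * g.scale y') ≤ g.L ^ t * g.L ^ (t * g.scale y) * Real.exp (α * δ₀ * g.dist y y') := by
  have hL0 : 0 < g.L := lt_of_lt_of_le one_pos hL
  have hexp1 : 1 ≤ Real.exp (α * δ₀ * g.dist y y') :=
    Real.one_le_exp (mul_nonneg hαδ (hd y y'))
  have hLt : 1 ≤ g.L ^ t := one_le_pow₀ hL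
  by_cases hjj : g.scale y' ≤ g.scale y
  · -- j′ ≤ j: no transfer needed
    calc g.L ^ (t * g.scale y') ≤ g.L ^ (t * g.scale y) :=
          pow_le_pow_right₀ hL (Nat.mul_le_mul_left t hjj)
      _ = 1 * g.L ^ (t * g.scale y) * 1 := by ring
      _ ≤ g.L ^ t * g.L ^ (t * g.scale y) * Real.exp (α * δ₀ * g.dist y y') :=
          mul_le_mul (mul_le_mul_of_nonneg_right hLt (pow_nonneg hL0.le _)) hexp1 zero_le_one
            (mul_nonneg (pow_nonneg hL0.le _) (pow_nonneg hL0.le _))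
  · -- j′ = j + 1 + m: L^{tm} ≤ e^{αδ₀d} by (2.60) and t log L ≤ αδ₀RM
    have hjj' : g.scale y < g.scale y' := not_le.mp hjj
    obtain ⟨m, hm⟩ : ∃ m : ℕ, g.scale y' = g.scale y + 1 + m := ⟨g.scale y' - g.scale y - 1, by omega⟩
    have hmax : max (|(g.scale y : ℝ) - g.scale y'| - 1) 0 = (m : ℝ) := by
      rw [hm]
      push_cast
      rw [show (g.scale y : ℝ) - (g.scale y + 1 + m) = -(1 + m) by ring, abs_neg,
        abs_of_nonneg (by positivity)]
      simp
    have h1 : α * δ₀ * g.R * g.M * (m : ℝ) ≤ α * δ₀ * g.dist y y' := by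
      have := h260 y y'
      rw [hmax, Real.exp_le_exp] at this
      linarith
    have h2 : (t * m : ℝ) * Real.log g.L ≤ α * δ₀ * g.dist y y' := by
      calc (t * m : ℝ) * Real.log g.L = (m : ℝ) * ((t : ℝ) * Real.log g.L) := by ring
        _ ≤ (m : ℝ) * (α * δ₀ * g.R * g.M) := mul_le_mul_of_nonneg_left hRM (Nat.cast_nonneg m)
        _ = α * δ₀ * g.R * g.M * (m : ℝ) := by ring
        _ ≤ α * δ₀ * g.dist y y' := h1
    have h3 : g.L ^ (t * m) ≤ Real.exp (α * δ₀ * g.dist y y') := by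
      have e : g.L ^ (t * m) = Real.exp ((t * m : ℝ) * Real.log g.L) := by
        rw [show ((t * m : ℝ)) * Real.log g.L = Real.log (g.L ^ (t * m)) by
          rw [Real.log_pow]; push_cast; ring, Real.exp_log (pow_pos hL0 _)]
      rw [e]
      exact Real.exp_le_exp.mpr h2
    calc g.L ^ (t * g.scale y') = g.L ^ t * g.L ^ (t * g.scale y) * g.L ^ (t * m) := by
          rw [hm, ← pow_add, ← pow_add]; ring_nf
      _ ≤ g.L ^ t * g.L ^ (t * g.scale y) * Real.exp (α * δ₀ * g.dist y y') :=
          mul_le_mul_of_nonneg_left h3 (mul_nonneg (pow_nonneg hL0.le _) (pow_nonneg hL0.le _))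

/-- The transfer in terms of the lengths L^jη (`B6.Geometry.len`): (L^{j′}η)^t ≤ L^t (L^jη)^t e^{αδ₀d(y,y′)}.
[cite: Balaban1984PropagatorsII, Lemma 2.1 (2.60) p.234] -/
theorem len_pow_le_of_ineq260 {δ₀ α : ℝ} (h260 : Ineq260 g δ₀ α) (hαδ : 0 ≤ α * δ₀)
    (hd : ∀ a b : g.Site, 0 ≤ g.dist a b) (hL : 1 ≤ g.L) (hη : 0 ≤ g.eta) (t : ℕ)
    (hRM : (t : ℝ) * Real.log g.L ≤ α * δ₀ * g.R * g.M) (y y' : g.Site) :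
    g.len y' ^ t ≤ g.L ^ t * g.len y ^ t * Real.exp (α * δ₀ * g.dist y y') := by
  have h := pow_scale_le_of_ineq260 h260 hαδ hd hL t hRM y y'
  have hηt : 0 ≤ g.eta ^ t := pow_nonneg hη t
  calc g.len y' ^ t = g.L ^ (t * g.scale y') * g.eta ^ t := by
        rw [B6.Geometry.len, mul_pow, ← pow_mul, mul_comm (g.scale y') t]
    _ ≤ (g.L ^ t * g.L ^ (t * g.scale y) * Real.exp (α * δ₀ * g.dist y y')) * g.eta ^ t :=
        mul_le_mul_of_nonneg_right h hηt
    _ = g.L ^ t * g.len y ^ t * Real.exp (α * δ₀ * g.dist y y') := by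
        rw [B6.Geometry.len, mul_pow, ← pow_mul, mul_comm (g.scale y) t]; ring

/-- The transfer for NEGATIVE powers: (L^jη)^{−t} ≤ L^t (L^{j′}η)^{−t} e^{αδ₀d(y,y′)} (lengths positive).
[cite: Balaban1984PropagatorsII, Lemma 2.1 (2.60) p.234] -/
theorem inv_len_pow_le_of_ineq260 {δ₀ α : ℝ} (h260 : Ineq260 g δ₀ α) (hαδ : 0 ≤ α * δ₀)
    (hd : ∀ a b : g.Site, 0 ≤ g.dist a b) (hL : 1 ≤ g.L) (hη : 0 < g.eta) (t : ℕ)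
    (hRM : (t : ℝ) * Real.log g.L ≤ α * δ₀ * g.R * g.M) (y y' : g.Site) :
    (g.len y ^ t)⁻¹ ≤ g.L ^ t * (g.len y' ^ t)⁻¹ * Real.exp (α * δ₀ * g.dist y y') := by
  have hL0 : 0 < g.L := lt_of_lt_of_le one_pos hL
  have hlen : ∀ z : g.Site, 0 < g.len z := fun z => by
    rw [B6.Geometry.len]; exact mul_pos (pow_pos hL0 _) hη
  have h := len_pow_le_of_ineq260 h260 hαδ hd hL hη.le t hRM y y'
  have hy : 0 < g.len y ^ t := pow_pos (hlen y) t
  have hy' : 0 < g.len y' ^ t := pow_pos (hlen y') t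
  rw [inv_le_iff_one_le_mul₀ hy]
  calc (1 : ℝ) = (g.len y' ^ t)⁻¹ * g.len y' ^ t := (inv_mul_cancel₀ hy'.ne').symm
    _ ≤ (g.len y' ^ t)⁻¹ * (g.L ^ t * g.len y ^ t * Real.exp (α * δ₀ * g.dist y y')) :=
        mul_le_mul_of_nonneg_left h (inv_pos.mpr hy').le
    _ = g.L ^ t * (g.len y' ^ t)⁻¹ * Real.exp (α * δ₀ * g.dist y y') * g.len y ^ t := by ring

/-- TRANSFER OF A BLOCK BOUND: an extra factor (L^{j′}η/L^jη)^t in a block bound is absorbed at the cost L^t and the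
rate αδ₀ — the printed remark of p. 398 for L²-entries. [cite: Balaban1985BackgroundPropagators, p.398 (remark after (3.47));
Balaban1984PropagatorsII, Lemma 2.1 (2.60) p.234] -/
theorem BlockBd.transfer {X₁ X₂ : Type} [Fintype X₁] [Fintype X₂] {blk₁ : X₁ → g.Site} {blk₂ : X₂ → g.Site}
    {T : (X₁ → ℝ) →ₗ[ℝ] (X₂ → ℝ)} {C : g.Site → g.Site → ℝ} {δ₀ α ρ : ℝ} (h260 : Ineq260 g δ₀ α)
    (hαδ : 0 ≤ α * δ₀) (hd : ∀ a b : g.Site, 0 ≤ g.dist a b) (hL : 1 ≤ g.L) (hη : 0 < g.eta) (t : ℕ)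
    (hRM : (t : ℝ) * Real.log g.L ≤ α * δ₀ * g.R * g.M) (hC : ∀ y y', 0 ≤ C y y')
    (h : BlockBd blk₁ blk₂ T
      (fun y y' => C y y' * (g.len y' ^ t * (g.len y ^ t)⁻¹) * Real.exp (-(ρ * g.dist y y')))) :
    BlockBd blk₁ blk₂ T (fun y y' => C y y' * g.L ^ t * Real.exp (-((ρ - α * δ₀) * g.dist y y'))) := by
  have hL0 : 0 < g.L := lt_of_lt_of_le one_pos hL
  have hlen : ∀ z : g.Site, 0 < g.len z := fun z => by
    rw [B6.Geometry.len]; exact mul_pos (pow_pos hL0 _) hη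
  refine h.mono fun y y' => ?_
  have ht := len_pow_le_of_ineq260 h260 hαδ hd hL hη.le t hRM y y'
  have hratio : g.len y' ^ t * (g.len y ^ t)⁻¹ ≤ g.L ^ t * Real.exp (α * δ₀ * g.dist y y') := by
    rw [← div_eq_mul_inv, div_le_iff₀ (pow_pos (hlen y) t)]
    calc g.len y' ^ t ≤ g.L ^ t * g.len y ^ t * Real.exp (α * δ₀ * g.dist y y') := ht
      _ = g.L ^ t * Real.exp (α * δ₀ * g.dist y y') * g.len y ^ t := by ring
  calc C y y' * (g.len y' ^ t * (g.len y ^ t)⁻¹) * Real.exp (-(ρ * g.dist y y'))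
      ≤ C y y' * (g.L ^ t * Real.exp (α * δ₀ * g.dist y y')) * Real.exp (-(ρ * g.dist y y')) :=
        mul_le_mul_of_nonneg_right (mul_le_mul_of_nonneg_left hratio (hC y y')) (Real.exp_nonneg _)
    _ = C y y' * g.L ^ t * Real.exp (-((ρ - α * δ₀) * g.dist y y')) := by
        rw [show -((ρ - α * δ₀) * g.dist y y') = α * δ₀ * g.dist y y' + -(ρ * g.dist y y') by ring,
          Real.exp_add]
        ring

end Transfer

/-! ## 7. The printed shape: entry 1 of (3.46) for G = (G₀⁻¹ − Δ′_π)⁻¹, with decay, in block-L² norms -/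

section Concrete

variable {X : Type} [Fintype X]

/-- **THEOREM 3.12, L²-ENTRY 1, WITH DECAY (block-L² form).**  Let ℓ > 0 be block lengths (ℓ_y = L^jη), G₀ an
operator on the lattice functions with the block-L² bound B·ℓ_yℓ_{y′}e^{−δ₁d(y,y′)} (the symmetrised form of entry 1 of
(3.46) for G₀, Theorem 3.3 — printed with (L^jη)², see `blockBd_symm`/`blockBd_geom` and the remark of p. 398), T′
(= Δ′_π, or Δ′_π + Δ^{(2)}_π) with the block-L² bound θ·ℓ_y⁻¹ℓ_{y′}⁻¹e^{−δ₁d(y,y′)} (θ = O(1)Mα₀: (3.120), (3.36),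
Theorem 3.1, (3.49) — the cell md §4), G = G₀ + G₀T′G ((3.130)), the row sum (2.61) at rate σ with constant c,
ρ + 2σ ≤ δ₁ and the SMALLNESS q = Bθc² < 1 (*"for α₀ sufficiently small"*).  Then G has the block-L² bound
B(1 − q)⁻¹·ℓ_yℓ_{y′}·e^{−ρd(y,y′)} — entry 1 of (3.46) for G together with the exponential decay asserted by
Theorem 3.12.  KERNEL-CHECKED; hypotheses = printed theorem shapes only.
[cite: Balaban1985BackgroundPropagators, Thm 3.12 p.423 + (3.130) p.421 + (3.46) p.398; Balaban1984PropagatorsII, Lemma 2.1 p.234] -/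
theorem thm312_entry1_l2 {blk : X → g.Site} {ℓ : g.Site → ℝ} (hℓ : ∀ y, 0 < ℓ y)
    {G G0 T' : Module.End ℝ (X → ℝ)} {B θ δ₁ ρ σ c : ℝ}
    (htri : Triangle254 g) (hd : ∀ a b : g.Site, 0 ≤ g.dist a b) (hrow : RowSum g σ c)
    (hB : 0 ≤ B) (hθ : 0 ≤ θ) (hρ : 0 ≤ ρ) (hσ : 0 ≤ σ) (hρδ : ρ + 2 * σ ≤ δ₁)
    (hG0 : BlockBd blk blk G0 (fun y y' => B * ℓ y * ℓ y' * Real.exp (-(δ₁ * g.dist y y'))))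
    (hT' : BlockBd blk blk T' (fun y y' => θ * (ℓ y)⁻¹ * (ℓ y')⁻¹ * Real.exp (-(δ₁ * g.dist y y'))))
    (hfix : G = G0 + G0 * T' * G) (hq : B * θ * c * c < 1) :
    BlockBd blk blk G (fun y y' => B * (1 - B * θ * c * c)⁻¹ * ℓ y * ℓ y' * Real.exp (-(ρ * g.dist y y'))) := by
  -- the two weighted block-L² spaces: b₁ (weights ℓ) and b₂ (weights ℓ⁻¹)
  have h₁ : ∀ y, 0 ≤ ℓ y := fun y => (hℓ y).le
  have h₂ : ∀ y, 0 ≤ (ℓ y)⁻¹ := fun y => (inv_pos.mpr (hℓ y)).le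
  have hG0w : HasMaj (l2w g blk ℓ h₁) (l2w g blk (fun y => (ℓ y)⁻¹) h₂) G0
      (fun a b => B * Real.exp (-(δ₁ * g.dist a b))) := by
    refine hasMaj_l2w_of_blockBd h₁ h₂ hG0 fun y y' => le_of_eq ?_
    have hy : ℓ y ≠ 0 := (hℓ y).ne'
    calc (ℓ y)⁻¹ * (B * ℓ y * ℓ y' * Real.exp (-(δ₁ * g.dist y y')))
        = B * Real.exp (-(δ₁ * g.dist y y')) * ℓ y' * ((ℓ y)⁻¹ * ℓ y) := by ring
      _ = B * Real.exp (-(δ₁ * g.dist y y')) * ℓ y' := by rw [inv_mul_cancel₀ hy, mul_one]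
  have hT'w : HasMaj (l2w g blk (fun y => (ℓ y)⁻¹) h₂) (l2w g blk ℓ h₁) T'
      (fun a b => θ * Real.exp (-(δ₁ * g.dist a b))) := by
    refine hasMaj_l2w_of_blockBd h₂ h₁ hT' fun y y' => le_of_eq ?_
    have hy : ℓ y ≠ 0 := (hℓ y).ne'
    calc ℓ y * (θ * (ℓ y)⁻¹ * (ℓ y')⁻¹ * Real.exp (-(δ₁ * g.dist y y')))
        = θ * Real.exp (-(δ₁ * g.dist y y')) * (ℓ y')⁻¹ * (ℓ y * (ℓ y)⁻¹) := by ring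
      _ = θ * Real.exp (-(δ₁ * g.dist y y')) * (ℓ y')⁻¹ := by rw [mul_inv_cancel₀ hy, mul_one]
  have hS : HasMaj (l2w g blk ℓ h₁) (l2w g blk (fun y => (ℓ y)⁻¹) h₂) (G0 ∘ₗ LinearMap.id)
      (fun a b => B * Real.exp (-(δ₁ * g.dist a b))) := by
    rw [LinearMap.comp_id]; exact hG0w
  obtain ⟨M₀, hM₀, hap⟩ := exists_hasMaj_l2w_const blk blk (G ∘ₗ LinearMap.id) hℓ h₂
  have hmain := rightEntry_majorant (b₀ := l2w g blk ℓ h₁) (b₁ := l2w g blk ℓ h₁)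
    (b₂ := l2w g blk (fun y => (ℓ y)⁻¹) h₂) htri hd hrow hB hθ hB hM₀ hρ hσ hρδ hG0w hT'w hS hfix hap
    (by simpa using hq)
  rw [LinearMap.comp_id] at hmain
  have hfin := blockBd_of_hasMaj_l2w hmain (fun y => inv_pos.mpr (hℓ y))
  refine hfin.mono fun y y' => le_of_eq ?_
  simp only [l2w_κ, one_mul]
  rw [div_inv_eq_mul]
  ring

/-- Rescaling in ratio form: a block bound (W₂(y))⁻¹W₁(y′)K(y,y′) IS the majorant K from the W₁- to the W₂-weighted
block-L² space (W₂ > 0). [folklore] -/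
theorem hasMaj_l2w_of_blockBd_ratio {X₁ X₂ : Type} [Fintype X₁] [Fintype X₂] {blk₁ : X₁ → g.Site}
    {blk₂ : X₂ → g.Site} {T : (X₁ → ℝ) →ₗ[ℝ] (X₂ → ℝ)} {K : g.Site → g.Site → ℝ} {W₁ W₂ : g.Site → ℝ}
    (hW₁ : ∀ y, 0 < W₁ y) (hW₂ : ∀ y, 0 < W₂ y)
    (hT : BlockBd blk₁ blk₂ T (fun y y' => (W₂ y)⁻¹ * W₁ y' * K y y')) :
    HasMaj (l2w g blk₁ W₁ fun y => (hW₁ y).le) (l2w g blk₂ W₂ fun y => (hW₂ y).le) T K := by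
  refine hasMaj_l2w_of_blockBd (fun y => (hW₁ y).le) (fun y => (hW₂ y).le) hT fun y y' => le_of_eq ?_
  have hy : W₂ y ≠ 0 := (hW₂ y).ne'
  calc W₂ y * ((W₂ y)⁻¹ * W₁ y' * K y y') = K y y' * W₁ y' * (W₂ y * (W₂ y)⁻¹) := by ring
    _ = K y y' * W₁ y' := by rw [mul_inv_cancel₀ hy, mul_one]

/-- **THEOREM 3.12, THE GENERAL L²-ENTRY E·G·F, WITH DECAY (block-L² form)** — the printed shape behind all six entries of
(3.46) for G (and, with T′ = Δ′_π + Δ^{(2)}_π, for G₁).  Data: block weights W₀ (domain of the right factor F), W₁, W₂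
(the pair carrying the Neumann series: G₀ from W₁ to W₂, T′ from W₂ back to W₁), W₁′ (the class in which the left
entry EG₀ receives T′) and W₃ (range of the left factor E), all positive (in the application powers (L^jη)^s, see the
md §5); the block-L² bounds of G₀, G₀F, EG₀, EG₀F (Theorem 3.3 (3.46), symmetrised/split by `blockBd_symm`,
`blockBd_geom`, p. 398) and of T′ in the two classes (md §4), ρ + 2σ ≤ δ₁, the row sum (2.61) at rate σ with constant
c, and the smallness q = Bθc² < 1.  Conclusion: EGF has the block-L² bound (W₃(y))⁻¹W₀(y′)(A_{EF} + B_Eθ′A(1 − q)⁻¹c²)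
e^{−ρd(y,y′)}.  KERNEL-CHECKED from `rightEntry_majorant`, `entry_majorant`, the a priori bound and the rescalings.
[cite: Balaban1985BackgroundPropagators, Thm 3.12 p.423 + (3.130) p.421 + (3.138) p.423 + (3.46) p.398;
Balaban1984PropagatorsII, Lemma 2.1 p.234] -/
theorem thm312_entry_l2 {X₀ X₃ : Type} [Fintype X₀] [Fintype X₃] {blk₀ : X₀ → g.Site} {blk : X → g.Site}
    {blk₃ : X₃ → g.Site} {W₀ W₁ W₂ W₁' W₃ : g.Site → ℝ} (hW₀ : ∀ y, 0 < W₀ y) (hW₁ : ∀ y, 0 < W₁ y)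
    (hW₂ : ∀ y, 0 < W₂ y) (hW₁' : ∀ y, 0 < W₁' y) (hW₃ : ∀ y, 0 < W₃ y)
    {G G0 T' : Module.End ℝ (X → ℝ)} {Eop : (X → ℝ) →ₗ[ℝ] (X₃ → ℝ)} {Fop : (X₀ → ℝ) →ₗ[ℝ] (X → ℝ)}
    {B θ A θ' BE AEF δ₁ ρ σ c : ℝ}
    (htri : Triangle254 g) (hd : ∀ a b : g.Site, 0 ≤ g.dist a b) (hrow : RowSum g σ c)
    (hB : 0 ≤ B) (hθ : 0 ≤ θ) (hA : 0 ≤ A) (hθ' : 0 ≤ θ') (hBE : 0 ≤ BE) (hAEF : 0 ≤ AEF) (hρ : 0 ≤ ρ)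
    (hσ : 0 ≤ σ) (hρδ : ρ + 2 * σ ≤ δ₁)
    (hG0 : BlockBd blk blk G0 (fun y y' => (W₂ y)⁻¹ * W₁ y' * (B * Real.exp (-(δ₁ * g.dist y y')))))
    (hT' : BlockBd blk blk T' (fun y y' => (W₁ y)⁻¹ * W₂ y' * (θ * Real.exp (-(δ₁ * g.dist y y')))))
    (hS : BlockBd blk₀ blk (G0 ∘ₗ Fop) (fun y y' => (W₂ y)⁻¹ * W₀ y' * (A * Real.exp (-(δ₁ * g.dist y y')))))
    (hT'2 : BlockBd blk blk T' (fun y y' => (W₁' y)⁻¹ * W₂ y' * (θ' * Real.exp (-(δ₁ * g.dist y y')))))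
    (hE : BlockBd blk blk₃ (Eop ∘ₗ G0) (fun y y' => (W₃ y)⁻¹ * W₁' y' * (BE * Real.exp (-(δ₁ * g.dist y y')))))
    (hEF : BlockBd blk₀ blk₃ (Eop ∘ₗ G0 ∘ₗ Fop)
      (fun y y' => (W₃ y)⁻¹ * W₀ y' * (AEF * Real.exp (-(δ₁ * g.dist y y')))))
    (hfix : G = G0 + G0 * T' * G) (hq : B * θ * c * c < 1) :
    BlockBd blk₀ blk₃ (Eop ∘ₗ G ∘ₗ Fop) (fun y y' => (W₃ y)⁻¹ * W₀ y' *
      ((AEF + BE * (θ' * (A * (1 - B * θ * c * c)⁻¹) * c) * c) * Real.exp (-(ρ * g.dist y y')))) := by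
  have hG0w := hasMaj_l2w_of_blockBd_ratio (g := g) hW₁ hW₂ hG0
  have hT'w := hasMaj_l2w_of_blockBd_ratio (g := g) hW₂ hW₁ hT'
  have hSw := hasMaj_l2w_of_blockBd_ratio (g := g) hW₀ hW₂ hS
  have hT'2w := hasMaj_l2w_of_blockBd_ratio (g := g) hW₂ hW₁' hT'2
  have hEw := hasMaj_l2w_of_blockBd_ratio (g := g) hW₁' hW₃ hE
  have hEFw := hasMaj_l2w_of_blockBd_ratio (g := g) hW₀ hW₃ hEF
  obtain ⟨M₀, hM₀, hap⟩ := exists_hasMaj_l2w_const blk₀ blk (G ∘ₗ Fop) hW₀ (fun y => (hW₂ y).le)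
  -- the right entry GF, in the W₂-class
  have hGF := rightEntry_majorant (b₀ := l2w g blk₀ W₀ fun y => (hW₀ y).le)
    (b₁ := l2w g blk W₁ fun y => (hW₁ y).le) (b₂ := l2w g blk W₂ fun y => (hW₂ y).le)
    htri hd hrow hB hθ hA hM₀ hρ hσ hρδ hG0w hT'w hSw hfix hap (by simpa using hq)
  simp only [l2w_κ, one_mul] at hGF
  have hq1 : 0 ≤ (1 - B * θ * c * c)⁻¹ := inv_nonneg.mpr (by linarith)
  -- the two-sided entry EGF
  have hEGF := entry_majorant (b₀ := l2w g blk₀ W₀ fun y => (hW₀ y).le)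
    (b₁' := l2w g blk W₁' fun y => (hW₁' y).le) (b₂' := l2w g blk W₂ fun y => (hW₂ y).le)
    (b₃ := l2w g blk₃ W₃ fun y => (hW₃ y).le) htri hd hrow hBE hθ' hAEF (mul_nonneg hA hq1) hρ hσ
    (by linarith) hEw hT'2w hEFw hGF hfix
  simp only [l2w_κ, one_mul] at hEGF
  have hfin := blockBd_of_hasMaj_l2w hEGF hW₃
  refine hfin.mono fun y y' => le_of_eq ?_
  rw [div_eq_mul_inv]
  ring

end Concrete

end Literature.MathematicalPhysics.QuantumFieldTheory.Balaban1983to89.B9SectDL2Decay
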